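/-
Origin: expansion seat `planner-pub-hodgecm-pv01-0`, handover 2026-08-18T03:30:56Z (`HOME/pub-hodgecm-pv01/lean/Pv01/LineField.lean`, md5 1f6ab409, 396 lines);
landed by the gen-5 packager in gate run 18 as `HodgeCM/PerL34/LineField.lean` (import ^import Pv01\.→import HodgeCM.PerL34. ×1).
-/
/-
pub-hodgecm cell, seat pub-hodgecm-pv01 (DAG-node prover #01) — node N33e of HOME/LEMMAS.md (carver v1).
Pure Mathlib below the `N33e` wrapper; no cited facts are consumed inside this file: the two PRINT inputs of the
node (real approximation; the structure of the ball as `U(2,1)/U(2)×U(1)` with its isotropy representation) enter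
as EXPLICIT HYPOTHESES of the theorems, labelled as such, to be discharged by the seat that instantiates the
analytic shell (LEMMAS.md §3 D6).
-/
import Summits.HodgeConjecture.HodgeCM.PerL34.LineFieldRigidity

/-!
# N33e — the line-field contradiction (PerL v5 Prop. 4.3 `prop:S12`, proof, tex ll. 667–681)

VERBATIM (PerL v5, blob d912a121, ll. 667–682; `inputs/2001/…paper-v5-d912a121.tex`):

> Suppose $u_1\wedge u_2=0$ for all $u_1\in\mathcal U_1$, $u_2\in\mathcal U_2$. Fix $0\ne u_1\in\mathcal U_1$; on
> the dense open set where $u_1\ne0$ every $u_2\in\mathcal U_2$ is pointwise proportional to $u_1$, so all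
> $2\times2$ minors $u_2\wedge u_2'$ ($u_2,u_2'\in\mathcal U_2$) vanish there, hence everywhere. Thus on the dense
> open set $\Omega:=\{x:\mathrm{ev}_x(\mathcal U_2)\ne0\}$ the evaluation images $\ell_x:=\mathrm{ev}_x(\mathcal
> U_2)\subset T^*_x\mathbb B^2$ are lines, forming a holomorphic line sub-bundle $\ell$ of $\Omega^1|_\Omega$
> (locally spanned by a non-vanishing $u_2$), and $\gamma^*\mathcal U_2=\mathcal U_2$ gives $\gamma\Omega=\Omega$
> and $\ell_{\gamma x}=\gamma_*\ell_x$ for $\gamma$ in the image $\Delta\subset\U(2,1)$ of $G_U(L_0)$. By real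
> approximation for the connected reductive group $G_U$ (\cite[Cor.~3.5(iii)]{San}, \cite[Thm.~7.7]{PR}), $\Delta$
> is dense in $\U(2,1)$. Fix $x_0\in\Omega$ and let $g\in\U(2,1)$ be any element with $gx_0\in\Omega$; choose
> $\gamma_n\in\Delta$, $\gamma_n\to g$; then $\gamma_nx_0\in\Omega$, $\gamma_nx_0\to gx_0\in\Omega$ and, by
> continuity of $\ell$ on the open set $\Omega$, $\ell_{gx_0}=\lim\ell_{\gamma_nx_0}=\lim(\gamma_n)_*\ell_{x_0}
> =g_*\ell_{x_0}$ (limits in the projectivised cotangent bundle, which is Hausdorff; the action of $\U(2,1)$ on it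
> is continuous). Every $k$ in the isotropy group $K_{x_0}\cong\U(2)\times\U(1)$ of $x_0$ has $kx_0=x_0\in\Omega$,
> so $k_*\ell_{x_0}=\ell_{x_0}$: the line $\ell_{x_0}\subset T^*_{x_0}\mathbb B^2\cong\C^2$ is $K_{x_0}$-invariant.
> But $K_{x_0}$ acts on $T^*_{x_0}\mathbb B^2$ through the standard representation of $\U(2)$ twisted by a
> character, and $\mathrm{SU}(2)$ is transitive on the lines of $\C^2$: contradiction. So some $u_1\wedge u_2\ne0$
> with $u_j\in \mathcal U_j$, and $S_{12}\ne0$ by the previous paragraph.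

## What is proved here (kernel-checked, no placeholders, Mathlib only)

The ANALYTIC SHELL of the node (LEMMAS.md §3 D6: holomorphic one-forms on `𝔹²`, the projectivised cotangent
bundle, `U(2,1)` and its isotropy) is not in Mathlib.  We therefore prove the node over the weakest abstract shell
that carries PerL's argument, and SEPARATELY prove the one genuinely finite-dimensional input (no `U(2)`-invariant
line in `ℂ²`).  The abstract shell (`ConformalShell` is NOT assumed; only the data below):

* `G` — a topological group (PerL: `U(2,1) = U(V_{3,ι₁})`), acting continuously on a topological space `X`
  (PerL: the ball `𝔹²`), with every orbit map `g ↦ g • x` onto (PerL: transitivity of `U(2,1)` on `𝔹²` —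
  hypothesis `htrans`, PRINT/standard, part of D6);
* `W` — a complex normed space (PerL: the cotangent fibre `ℂ²`, via the global trivialisation
  `T^*𝔹² = 𝔹² × ℂ²` by `dz₁, dz₂`); one-forms are functions `u : X → W`; the action of `G` on one-forms is
  recorded only through a "derivative cocycle" `A : G → X → (W →L[ℂ] W)` with `(γ ⋆ u)(γ • x) = A γ x (u x)`
  (PerL: `A γ x = (Dγ_x)^{-T}`), each `A γ x` injective, and `h ↦ A h x₀ w` continuous (continuity of the
  action on the cotangent bundle, l. 676);
* `Δ ≤ G` dense (PerL: REAL APPROXIMATION, [San] Cor. 3.5(iii), [PR] Thm. 7.7 — hypothesis `hΔ`, PRINT);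
* the isotropy group of `x₀` moves every line of the fibre: `∀ v ≠ 0, ∃ k, k • x₀ = x₀ ∧ A k x₀ v ∉ ℂv`
  (hypothesis `hiso`; PerL ll. 679–681: "`K_{x₀}` acts … through the standard representation of `U(2)` twisted by
  a character, and `SU(2)` is transitive on the lines of `ℂ²`" — the representation-theoretic half is D6/PRINT,
  the "no invariant line" half is PROVED below for the standard representation: `Fibre.exists_SU2_moves_line`,
  `Fibre.hiso_of_contains_SU2`);
* `𝒰₁, 𝒰₂` — non-zero `ℂ`-subspaces of CONTINUOUS one-forms, `Δ`-stable (`γ ⋆ 𝒰ᵢ ⊆ 𝒰ᵢ` for `γ ∈ Δ`; PerL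
  l. 659 "stable under `γ^*`" and N33c).

CONCLUSION (`exists_wedge_ne_zero`): some `u₁ ∈ 𝒰₁`, `u₂ ∈ 𝒰₂` and `x` have `u₁(x) ∧ u₂(x) ≠ 0`, i.e.
`u₁(x), u₂(x)` linearly independent — PerL's "So some `u₁ ∧ u₂ ≠ 0` with `u_j ∈ 𝒰_j`" (l. 681).

DIFFERENCES FROM THE TEX, all on the safe side (recorded in HOME/DIVERGENCE.md by this seat):
(1) holomorphy is NOT used — continuity of the forms suffices: instead of "the dense open set where `u₁ ≠ 0`"
(identity theorem) we use that the common zero set of a `Δ`-stable family is closed and `Δ`-stable, hence empty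
or everything because `Δ`-orbits are dense (`htrans` + `hΔ`); (2) the limit `ℓ_{gx₀} = lim ℓ_{γ_n x₀}` in the
projectivised cotangent bundle is replaced by the equivalent closed-condition argument on PAIRS OF VECTORS
(`{h : A h x₀ v ∧ u₂(h x₀) = 0}` is closed and contains the dense `Δ`), so no topology on the space of lines is
needed (the tex's version with an abstract Hausdorff line space is ALSO checked: `LineField.smul_eq_of_dense`,
`LineField.stabilizer_smul_eq` in `LineFieldRigidity.lean`); (3) the cocycle identity of `A` and `Δ`-stability
in the sense `γΩ = Ω` are not needed.
-/

set_option autoImplicit false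

namespace HodgeCM
namespace PerL34
namespace LineField

open Set Topology

section Core

variable {G X W : Type*} [TopologicalSpace G] [Group G]
  [TopologicalSpace X] [MulAction G X] [ContinuousSMul G X]
  [NormedAddCommGroup W] [NormedSpace ℂ W]

/-- `Δ`-stability of a space `𝒰` of `W`-valued one-forms under push-forward through the cocycle `A`:
for `γ ∈ Δ` and `u ∈ 𝒰` the form `γ ⋆ u`, characterised by `(γ ⋆ u)(γ • x) = A γ x (u x)`, lies in `𝒰`
(PerL l. 659: "`𝒰_i` … stable under `γ^*` for `γ ∈ G_U(L₀)`"; for a subgroup, pull-back stability and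
push-forward stability are the same thing). -/
def StableUnder (Δ : Subgroup G) (A : G → X → (W →L[ℂ] W)) (𝒰 : Submodule ℂ (X → W)) : Prop :=
  ∀ γ : G, γ ∈ Δ → ∀ u ∈ 𝒰, ∃ u' ∈ 𝒰, ∀ x : X, u' (γ • x) = A γ x (u x)

/-- Step "hence everywhere" without holomorphy (replaces PerL's identity-theorem density, ll. 668–670): the
common zero set of a non-zero `Δ`-stable space of continuous forms is EMPTY, because it is closed, `Δ`-stable and
`Δ`-orbits are dense. -/
theorem exists_apply_ne_zero (Δ : Subgroup G) (hΔ : Dense (Δ : Set G))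
    (htrans : ∀ x : X, Function.Surjective fun g : G => g • x)
    (A : G → X → (W →L[ℂ] W)) (hAinj : ∀ g x, Function.Injective (A g x))
    (𝒰 : Submodule ℂ (X → W)) (hcont : ∀ u ∈ 𝒰, Continuous u) (hstab : StableUnder Δ A 𝒰)
    (hne : 𝒰 ≠ ⊥) (x : X) : ∃ u ∈ 𝒰, u x ≠ 0 := by
  by_contra hx
  push Not at hx
  -- the common zero set
  set Z : Set X := {y : X | ∀ u ∈ 𝒰, u y = 0} with hZ
  have hZclosed : IsClosed Z := by
    have : Z = ⋂ u ∈ 𝒰, (fun y : X => u y) ⁻¹' {0} := by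
      ext y; simp [hZ]
    rw [this]
    exact isClosed_biInter fun u hu => (isClosed_singleton.preimage (hcont u hu))
  have hZstab : ∀ γ : G, γ ∈ Δ → ∀ y ∈ Z, γ • y ∈ Z := by
    intro γ hγ y hy u hu
    -- push `u` forward by `γ⁻¹ ∈ Δ`: `u' (γ⁻¹ • (γ • y)) = A γ⁻¹ (γ • y) (u (γ • y))`, and `u' y = 0`
    obtain ⟨u', hu', hu'eq⟩ := hstab γ⁻¹ (Δ.inv_mem hγ) u hu
    have h1 := hu'eq (γ • y)
    rw [inv_smul_smul, hy u' hu'] at h1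
    exact hAinj _ _ (by rw [← h1, map_zero])
  have hxZ : x ∈ Z := hx
  -- the dense `Δ`-orbit of `x` lies in the closed set `Z`, so `Z = univ`
  have horb : (fun g : G => g • x) '' (Δ : Set G) ⊆ Z := by
    rintro _ ⟨γ, hγ, rfl⟩; exact hZstab γ hγ x hxZ
  have hZuniv : Z = univ := by
    have hd := dense_orbit_of_dense (X := X) Δ hΔ x (htrans x)
    have : closure ((fun g : G => g • x) '' (Δ : Set G)) ⊆ Z := closure_minimal horb hZclosed
    rw [hd.closure_eq] at this
    exact eq_univ_of_univ_subset this
  apply hne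
  rw [Submodule.eq_bot_iff]
  intro u hu
  funext y
  have hy : y ∈ Z := by rw [hZuniv]; exact mem_univ y
  exact hy u hu

/-- Two vectors on the line of a third are linearly dependent (the "2×2 minors vanish" step, l. 669). -/
theorem not_linearIndependent_of_mem_span {a b c : W} (hb : b ∈ (ℂ ∙ a)) (hc : c ∈ (ℂ ∙ a)) :
    ¬ LinearIndependent ℂ ![b, c] := by
  intro hli
  rw [Submodule.mem_span_singleton] at hb hc
  obtain ⟨s, rfl⟩ := hb
  obtain ⟨t, rfl⟩ := hc
  rw [LinearIndependent.pair_iff] at hli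
  -- `t • (s • a) - s • (t • a) = 0`
  have h := hli t (-s) (by rw [smul_smul, neg_smul, smul_smul, mul_comm t s]; exact add_neg_cancel _)
  -- so `t = 0`, whence the second vector is `0`, contradicting independence
  have hli' : LinearIndependent ℂ ![s • a, t • a] := by
    rw [LinearIndependent.pair_iff]; exact hli
  have := hli'.ne_zero 1
  simp [h.1] at this

/-- **The line-field contradiction, abstract shell** (PerL v5 Prop. 4.3, ll. 667–681).  See the module
docstring for the dictionary.  Hypotheses labelled PRINT are the node's published inputs, to be discharged by the
instantiating seat; everything else is kernel-checked here. -/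
theorem exists_wedge_ne_zero (Δ : Subgroup G)
    (hΔ : Dense (Δ : Set G))                                    -- PRINT: real approximation [San 3.5(iii)], [PR 7.7]
    (htrans : ∀ x : X, Function.Surjective fun g : G => g • x)  -- PRINT/D6: `U(2,1)` transitive on `𝔹²`
    (A : G → X → (W →L[ℂ] W)) (hAinj : ∀ g x, Function.Injective (A g x))
    (x₀ : X) (hAcont : ∀ w : W, Continuous fun g : G => A g x₀ w)
    (hiso : ∀ v : W, v ≠ 0 → ∃ k : G, k • x₀ = x₀ ∧ LinearIndependent ℂ ![A k x₀ v, v])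
                                                                -- D6 (isotropy rep.) + `Fibre.exists_SU2_moves_line`
    (𝒰₁ 𝒰₂ : Submodule ℂ (X → W))
    (hcont₁ : ∀ u ∈ 𝒰₁, Continuous u) (hcont₂ : ∀ u ∈ 𝒰₂, Continuous u)
    (hstab₁ : StableUnder Δ A 𝒰₁) (hstab₂ : StableUnder Δ A 𝒰₂)
    (hne₁ : 𝒰₁ ≠ ⊥) (hne₂ : 𝒰₂ ≠ ⊥) :
    ∃ u₁ ∈ 𝒰₁, ∃ u₂ ∈ 𝒰₂, ∃ x : X, LinearIndependent ℂ ![u₁ x, u₂ x] := by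
  by_contra H
  push Not at H
  -- Step 1 (ll. 668–670): all `2×2` minors of `𝒰₂` vanish identically.
  have minors : ∀ x : X, ∀ u ∈ 𝒰₂, ∀ u' ∈ 𝒰₂, ¬ LinearIndependent ℂ ![u x, u' x] := by
    intro x u hu u' hu'
    obtain ⟨u₁, hu₁, hu₁x⟩ :=
      exists_apply_ne_zero Δ hΔ htrans A hAinj 𝒰₁ hcont₁ hstab₁ hne₁ x
    exact not_linearIndependent_of_mem_span
      (mem_span_of_not_linearIndependent (H u₁ hu₁ u hu x) hu₁x)
      (mem_span_of_not_linearIndependent (H u₁ hu₁ u' hu' x) hu₁x)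
  -- Step 2 (ll. 670–677): a non-vanishing `u₂` at `x₀`; the closed condition "`A h x₀ v ∧ u₂ (h • x₀) = 0`"
  -- holds on the dense subgroup `Δ` (equivariance `ℓ_{γx₀} = γ_* ℓ_{x₀}`), hence on all of `G`.
  obtain ⟨u₂, hu₂, hv⟩ := exists_apply_ne_zero Δ hΔ htrans A hAinj 𝒰₂ hcont₂ hstab₂ hne₂ x₀
  set v : W := u₂ x₀ with hvdef
  set F : G → (Fin 2 → W) := fun h => ![A h x₀ v, u₂ (h • x₀)] with hF
  have hFcont : Continuous F := by
    have h1 : Continuous fun h : G => A h x₀ v := hAcont v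
    have h2 : Continuous fun h : G => u₂ (h • x₀) := (hcont₂ u₂ hu₂).comp (by fun_prop)
    exact h1.matrixVecCons (h2.matrixVecCons continuous_const)
  have hclosed : IsClosed {h : G | ¬ LinearIndependent ℂ (F h)} := by
    have : {h : G | ¬ LinearIndependent ℂ (F h)} = F ⁻¹' {f | LinearIndependent ℂ f}ᶜ := by
      ext h; simp
    rw [this]
    exact (isOpen_setOf_linearIndependent.isClosed_compl).preimage hFcont
  have hΔsub : (Δ : Set G) ⊆ {h : G | ¬ LinearIndependent ℂ (F h)} := by
    intro γ hγ
    obtain ⟨u', hu', hu'eq⟩ := hstab₂ γ hγ u₂ hu₂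
    have hFγ : F γ = ![u' (γ • x₀), u₂ (γ • x₀)] := by
      simp only [hF, hu'eq x₀, hvdef]
    rw [mem_setOf_eq, hFγ]
    exact minors (γ • x₀) u' hu' u₂ hu₂
  have hall : ∀ h : G, ¬ LinearIndependent ℂ (F h) := by
    intro h
    have : h ∈ closure (Δ : Set G) := by rw [hΔ.closure_eq]; exact mem_univ h
    exact closure_minimal hΔsub hclosed this
  -- Step 3 (ll. 677–681): the isotropy group of `x₀` then fixes the line `ℂ v` — contradiction with `hiso`.
  obtain ⟨k, hk, hli⟩ := hiso v hv
  apply hall k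
  simp only [hF, hk]
  exact hli

end Core

section Fibre

/-! ### The fibre: no line of `ℂ²` is invariant under `SU(2)` (PerL l. 680–681)

"`SU(2)` is transitive on the lines of `ℂ²`" is used only through its consequence that NO line is fixed by all of
`SU(2)`; we prove that consequence directly with two explicit special unitary matrices, and then in the form
consumed by `exists_wedge_ne_zero` ("every non-zero vector is moved off its line"), also after twisting by
scalars (PerL: "the standard representation of `U(2)` twisted by a character") and after transport to an
arbitrary fibre `W ≃L[ℂ] (Fin 2 → ℂ)`. -/

open Matrix

/-- The quarter turn `J = !![0,-1; 1,0] ∈ SU(2)`. -/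
theorem quarterTurn_mem_SU2 : !![(0 : ℂ), -1; 1, 0] ∈ Matrix.specialUnitaryGroup (Fin 2) ℂ := by
  rw [Matrix.mem_specialUnitaryGroup_iff, Matrix.mem_unitaryGroup_iff]
  refine ⟨?_, ?_⟩
  · ext i j
    fin_cases i <;> fin_cases j <;>
      simp [Matrix.mul_apply, Fin.sum_univ_two, Matrix.star_eq_conjTranspose, Matrix.conjTranspose_apply]
  · simp [Matrix.det_fin_two]

/-- The phase matrix `diag(i, −i) ∈ SU(2)`. -/
theorem phase_mem_SU2 : !![Complex.I, 0; 0, -Complex.I] ∈ Matrix.specialUnitaryGroup (Fin 2) ℂ := by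
  rw [Matrix.mem_specialUnitaryGroup_iff, Matrix.mem_unitaryGroup_iff]
  refine ⟨?_, ?_⟩
  · ext i j
    fin_cases i <;> fin_cases j <;>
      simp [Matrix.mul_apply, Fin.sum_univ_two, Matrix.star_eq_conjTranspose, Matrix.conjTranspose_apply]
  · simp [Matrix.det_fin_two]

/-- Matrix–vector products of the two witnesses. -/
theorem quarterTurn_mulVec (v : Fin 2 → ℂ) : !![(0 : ℂ), -1; 1, 0] *ᵥ v = ![-(v 1), v 0] := by
  rw [Matrix.mulVec_fin_two]; simp

/-- (Ported verbatim from the HodgeCMPerL package; no docstring in the source.) -/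
theorem phase_mulVec (v : Fin 2 → ℂ) :
    !![Complex.I, 0; 0, -Complex.I] *ᵥ v = ![Complex.I * v 0, -(Complex.I * v 1)] := by
  rw [Matrix.mulVec_fin_two]; simp

/-- **No `SU(2)`-invariant line in `ℂ²`, with a scalar twist allowed**: for every non-zero `v ∈ ℂ²` and every
non-zero scalar `c` there is `g ∈ SU(2)` with `c • (g v)` off the line `ℂ v`. -/
theorem exists_SU2_moves_line (v : Fin 2 → ℂ) (hv : v ≠ 0) (c : ℂ) (hc : c ≠ 0) :
    ∃ g ∈ Matrix.specialUnitaryGroup (Fin 2) ℂ, LinearIndependent ℂ ![c • (g *ᵥ v), v] := by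
  have hv' : ¬ (v 0 = 0 ∧ v 1 = 0) := by
    rintro ⟨h0, h1⟩; apply hv; funext i; fin_cases i <;> simp [h0, h1]
  by_cases hq : v 0 ^ 2 + v 1 ^ 2 = 0
  · -- isotropic vector (`v₀² + v₁² = 0`, so `v₀, v₁ ≠ 0`): use the phase matrix
    refine ⟨!![Complex.I, 0; 0, -Complex.I], phase_mem_SU2, ?_⟩
    have h0 : v 0 ≠ 0 := by
      intro h0; apply hv'; refine ⟨h0, ?_⟩
      have : v 1 ^ 2 = 0 := by rw [h0] at hq; simpa using hq
      exact pow_eq_zero_iff (n := 2) (by norm_num) |>.mp this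
    have h1 : v 1 ≠ 0 := by
      intro h1; apply hv'; refine ⟨?_, h1⟩
      have : v 0 ^ 2 = 0 := by rw [h1] at hq; simpa using hq
      exact pow_eq_zero_iff (n := 2) (by norm_num) |>.mp this
    rw [phase_mulVec]
    have hne : c • ![Complex.I * v 0, -(Complex.I * v 1)] ≠ 0 := by
      intro h
      have e0 := congr_fun h 0
      simp only [Pi.smul_apply, smul_eq_mul, Matrix.cons_val_zero, Pi.zero_apply, mul_eq_zero,
        Complex.I_ne_zero, false_or] at e0
      rcases e0 with h | h
      · exact hc h
      · exact h0 h
    rw [LinearIndependent.pair_iff' hne]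
    intro a ha
    have e0 := congr_fun ha 0
    have e1 := congr_fun ha 1
    simp only [Pi.smul_apply, smul_eq_mul, Matrix.cons_val_zero, Matrix.cons_val_one] at e0 e1
    -- e0 : a * (c * (I * v 0)) = v 0,  e1 : a * (c * -(I * v 1)) = v 1
    have k0 : a * c * Complex.I = 1 := by
      have : (a * c * Complex.I - 1) * v 0 = 0 := by linear_combination e0
      rcases mul_eq_zero.mp this with h | h
      · linear_combination h
      · exact absurd h h0
    have : (a * c * Complex.I + 1) * v 1 = 0 := by linear_combination (-1 : ℂ) * e1
    rcases mul_eq_zero.mp this with h | h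
    · have h2 : (2 : ℂ) = 0 := by linear_combination h - k0
      norm_num at h2
    · exact h1 h
  · -- generic vector: use the quarter turn
    refine ⟨!![(0 : ℂ), -1; 1, 0], quarterTurn_mem_SU2, ?_⟩
    rw [quarterTurn_mulVec]
    have hne : c • ![-(v 1), v 0] ≠ 0 := by
      intro h
      have e0 := congr_fun h 0
      have e1 := congr_fun h 1
      simp only [Pi.smul_apply, smul_eq_mul, Matrix.cons_val_zero, Matrix.cons_val_one,
        Pi.zero_apply, mul_eq_zero, neg_eq_zero] at e0 e1
      rcases e0 with h | h
      · exact hc h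
      · rcases e1 with h' | h'
        · exact hc h'
        · exact hv' ⟨h', h⟩
    rw [LinearIndependent.pair_iff' hne]
    intro a ha
    have e0 := congr_fun ha 0
    have e1 := congr_fun ha 1
    simp only [Pi.smul_apply, smul_eq_mul, Matrix.cons_val_zero, Matrix.cons_val_one] at e0 e1
    -- e0 : a * (c * -(v 1)) = v 0,  e1 : a * (c * v 0) = v 1
    apply hq
    have h2 : (1 + (a * c) ^ 2) * v 0 = 0 := by linear_combination (-1 : ℂ) * e0 + (a * c) * e1
    rcases mul_eq_zero.mp h2 with h | h
    · linear_combination (v 0) ^ 2 * h - (v 1 + a * c * v 0) * e1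
    · exfalso
      have h3 : v 1 = 0 := by rw [h, mul_zero, mul_zero] at e1; exact e1.symm
      exact hv' ⟨h, h3⟩

/-- Scaling the first vector by a non-zero scalar preserves linear independence of a pair. -/
theorem linearIndependent_pair_smul {V : Type*} [AddCommGroup V] [Module ℂ V] {x y : V}
    (h : LinearIndependent ℂ ![x, y]) (c : ℂ) (hc : c ≠ 0) : LinearIndependent ℂ ![c • x, y] := by
  rw [LinearIndependent.pair_iff] at h ⊢
  intro s t hst
  have hst' : (s * c) • x + t • y = 0 := by rwa [mul_smul]
  obtain ⟨h1, h2⟩ := h (s * c) t hst'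
  exact ⟨(mul_eq_zero.mp h1).resolve_right hc, h2⟩

/-- Uniform version: ONE `g ∈ SU(2)` moves `v` off its line after every non-zero scalar twist (the twist by a
character of the isotropy group does not move lines). -/
theorem exists_SU2_moves_line_twisted (v : Fin 2 → ℂ) (hv : v ≠ 0) :
    ∃ g ∈ Matrix.specialUnitaryGroup (Fin 2) ℂ, ∀ c : ℂ, c ≠ 0 → LinearIndependent ℂ ![c • (g *ᵥ v), v] := by
  obtain ⟨g, hg, hli⟩ := exists_SU2_moves_line v hv 1 one_ne_zero
  rw [one_smul] at hli
  exact ⟨g, hg, fun c hc => linearIndependent_pair_smul hli c hc⟩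

end Fibre

section Transport

variable {G X W : Type*} [Group G] [MulAction G X]
  [NormedAddCommGroup W] [NormedSpace ℂ W]

/-- **The isotropy hypothesis of `exists_wedge_ne_zero` from the structure of the fibre** (PerL ll. 679–681):
if, after identifying the fibre `W` at `x₀` with `ℂ²` (`e`), the isotropy group of `x₀` acts through maps
containing every `g ∈ SU(2)` up to a non-zero scalar (PRINT/D6: "`K_{x₀} ≅ U(2) × U(1)` acts on
`T^*_{x₀}𝔹² ≅ ℂ²` through the standard representation of `U(2)` twisted by a character"), then every non-zero
vector of `W` is moved off its line by some element of the isotropy group (kernel-checked from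
`exists_SU2_moves_line_twisted`). -/
theorem hiso_of_SU2 (A : G → X → (W →L[ℂ] W)) (x₀ : X) (e : W ≃ₗ[ℂ] (Fin 2 → ℂ))
    (hK : ∀ g ∈ Matrix.specialUnitaryGroup (Fin 2) ℂ,
      ∃ k : G, k • x₀ = x₀ ∧ ∃ c : ℂ, c ≠ 0 ∧ ∀ w : W, e (A k x₀ w) = c • (Matrix.mulVec g (e w))) :
    ∀ v : W, v ≠ 0 → ∃ k : G, k • x₀ = x₀ ∧ LinearIndependent ℂ ![A k x₀ v, v] := by
  intro v hv
  have hv' : e v ≠ 0 := by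
    intro h; exact hv (e.map_eq_zero_iff.mp h)
  obtain ⟨g, hg, hli⟩ := exists_SU2_moves_line_twisted (e v) hv'
  obtain ⟨k, hk, c, hc, hcw⟩ := hK g hg
  refine ⟨k, hk, ?_⟩
  have key : LinearIndependent ℂ (e ∘ ![A k x₀ v, v]) := by
    have : (e ∘ ![A k x₀ v, v]) = ![c • (Matrix.mulVec g (e v)), e v] := by
      funext i; fin_cases i <;> simp [hcw]
    rw [this]; exact hli c hc
  exact key.of_comp e.toLinearMap

end Transport

end LineField

/-! ### The node statement `N33e` (typed by the prover seat from the tex block, LEMMAS.md v1 having no carver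
stub yet; the analytic shell D6 is abstracted as explained in the module docstring). -/

universe u₁ u₂ u₃ in
/-- **N33e (PerL v5 Prop. 4.3, proof, ll. 667–681) — LINE-FIELD CONTRADICTION**, over the abstract shell:
for a topological group `G` acting continuously and transitively on `X`, a dense subgroup `Δ` (REAL
APPROXIMATION, PRINT: [San] Cor. 3.5(iii), [PR] Thm. 7.7), a derivative cocycle `A` (injective fibrewise,
continuous in the group variable at `x₀`) whose isotropy representation at `x₀` contains `SU(2)` up to scalars
after an identification of the fibre with `ℂ²` (PRINT/D6: `𝔹² = U(2,1)/(U(2)×U(1))`, isotropy representation =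
standard ⊗ character), and two non-zero `Δ`-stable spaces `𝒰₁, 𝒰₂` of continuous one-forms, SOME wedge
`u₁(x) ∧ u₂(x)` is non-zero. -/
def N33e_statement : Prop :=
  ∀ (G : Type u₁) (X : Type u₂) (W : Type u₃) [TopologicalSpace G] [Group G] [TopologicalSpace X]
    [MulAction G X] [ContinuousSMul G X] [NormedAddCommGroup W] [NormedSpace ℂ W]
    (Δ : Subgroup G), Dense (Δ : Set G) → (∀ x : X, Function.Surjective fun g : G => g • x) →
    ∀ (A : G → X → (W →L[ℂ] W)), (∀ g x, Function.Injective (A g x)) →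
    ∀ (x₀ : X), (∀ w : W, Continuous fun g : G => A g x₀ w) →
    ∀ (e : W ≃ₗ[ℂ] (Fin 2 → ℂ)),
    (∀ g ∈ Matrix.specialUnitaryGroup (Fin 2) ℂ,
      ∃ k : G, k • x₀ = x₀ ∧ ∃ c : ℂ, c ≠ 0 ∧ ∀ w : W, e (A k x₀ w) = c • (Matrix.mulVec g (e w))) →
    ∀ (𝒰₁ 𝒰₂ : Submodule ℂ (X → W)), (∀ u ∈ 𝒰₁, Continuous u) → (∀ u ∈ 𝒰₂, Continuous u) →
    LineField.StableUnder Δ A 𝒰₁ → LineField.StableUnder Δ A 𝒰₂ → 𝒰₁ ≠ ⊥ → 𝒰₂ ≠ ⊥ →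
    ∃ u₁ ∈ 𝒰₁, ∃ u₂ ∈ 𝒰₂, ∃ x : X, LinearIndependent ℂ ![u₁ x, u₂ x]

/-- **N33e holds** (kernel-checked; axioms `propext`, `Classical.choice`, `Quot.sound`). -/
theorem N33e_holds : N33e_statement := by
  unfold N33e_statement
  intro G X W _ _ _ _ _ _ _ Δ hΔ htrans A hAinj x₀ hAcont e hK 𝒰₁ 𝒰₂ hc₁ hc₂ hs₁ hs₂ hne₁ hne₂
  exact LineField.exists_wedge_ne_zero Δ hΔ htrans A hAinj x₀ hAcont (LineField.hiso_of_SU2 A x₀ e hK)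
    𝒰₁ 𝒰₂ hc₁ hc₂ hs₁ hs₂ hne₁ hne₂

end PerL34
end HodgeCM
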